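import Mathlib

/-!
# Symmetric integer polynomials in the roots of a monic integer polynomial take integer values (venture `DiscreteObjects`, target L)

Cell `pub-namedobj`, seat `pub-namedobj-mahler-g26`. Framing: lottery ticket; floor = certified bounds/negative ranges.

**Lemma** (`exists_int_eq_aeval_of_isSymmetric`; folklore — the fundamental theorem of symmetric polynomials,
Mathlib's `MvPolynomial.esymmAlgHom_surjective`, plus Vieta, Mathlib's `Polynomial.coeff_eq_esymm_roots_of_card`).
Let `f ∈ ℤ[X]` be monic and let `α : σ → ℂ` enumerate its complex roots with multiplicity.  Then every SYMMETRIC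
`S ∈ ℤ[X_σ]` satisfies `S(α) ∈ ℤ`.

**Application** (`exists_int_eq_prod_pow_sub_pow`, brick for the weak Dobrowolski bound [cite: MckeeSmyth2021,
Theorem 3.11]): for every `p`, `D_p = ∏_{i ≠ j} (α_i^p - α_j^p)` is an integer; hence `D_p ≠ 0 ⇒ |D_p| ≥ 1`
(`one_le_norm_prod_pow_sub_pow`) — "the second product could be `0`; … enables us to assume `∏_{i≠j} |α_i^p - α_j^p| ≥ 1`"
in the printed proof.  No new mathematics.
-/

namespace Summit.Ventures.DiscreteObjects.Mahler

open MvPolynomial Finset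

/-- The elementary symmetric functions of the roots (with multiplicity) of a monic integer polynomial are integers:
`e_k(α) = (-1)^k f_{N-k}` for `k ≤ N = deg f` (Vieta), and `0` for `k > N`. -/
theorem exists_int_eq_esymm_roots (f : Polynomial ℤ) (hmon : f.Monic) (k : ℕ) :
    ∃ z : ℤ, ((f.map (Int.castRingHom ℂ)).roots.esymm k : ℂ) = (z : ℂ) := by
  set g := f.map (Int.castRingHom ℂ) with hg
  have hgmon : g.Monic := hmon.map _
  have hsplit : g.roots.card = g.natDegree := (Polynomial.splits_iff_card_roots.1 (IsAlgClosed.splits g))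
  by_cases hk : k ≤ g.natDegree
  · -- Vieta: coeff (N - k) = lead * (-1)^(N - (N-k)) * esymm (N - (N - k))
    have hv := Polynomial.coeff_eq_esymm_roots_of_card hsplit (k := g.natDegree - k) (Nat.sub_le _ _)
    rw [hgmon.leadingCoeff, one_mul, Nat.sub_sub_self hk] at hv
    refine ⟨(-1) ^ k * f.coeff (g.natDegree - k), ?_⟩
    have h1 : ((-1 : ℂ) ^ k) * ((-1 : ℂ) ^ k) = 1 := by
      rw [← mul_pow, neg_one_mul, neg_neg, one_pow]
    calc (g.roots.esymm k : ℂ) = ((-1 : ℂ) ^ k * (-1) ^ k) * g.roots.esymm k := by rw [h1, one_mul]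
      _ = (-1 : ℂ) ^ k * g.coeff (g.natDegree - k) := by rw [hv]; ring
      _ = (((-1) ^ k * f.coeff (g.natDegree - k) : ℤ) : ℂ) := by
          rw [hg, Polynomial.coeff_map, eq_intCast]
          push_cast
          ring
  · refine ⟨0, ?_⟩
    push Not at hk
    rw [Multiset.esymm, Multiset.powersetCard_eq_empty k (by rw [hsplit]; exact hk)]
    simp

/-- **Symmetric integer polynomials in the roots of a monic integer polynomial are integers.**  `α : σ → ℂ`
enumerates the roots of `f` with multiplicity: `univ.val.map α = (f.map ℤ→ℂ).roots`. -/
theorem exists_int_eq_aeval_of_isSymmetric {σ : Type*} [Fintype σ] [DecidableEq σ] (f : Polynomial ℤ) (hmon : f.Monic)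
    (α : σ → ℂ) (hα : (Finset.univ.val.map α : Multiset ℂ) = (f.map (Int.castRingHom ℂ)).roots)
    (S : MvPolynomial σ ℤ) (hS : S.IsSymmetric) : ∃ z : ℤ, MvPolynomial.aeval α S = (z : ℂ) := by
  classical
  set n := Fintype.card σ with hn
  -- fundamental theorem: `S = T(e_1, …, e_n)`
  obtain ⟨T, hT⟩ := esymmAlgHom_surjective ℤ (σ := σ) (n := n) le_rfl ⟨S, hS⟩
  have hT' : MvPolynomial.aeval (fun i : Fin n => esymm σ ℤ (i + 1)) T = S := by
    have := congrArg Subtype.val hT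
    rw [esymmAlgHom_apply] at this
    exact this
  -- the values `e_{i+1}(α)` are integers
  have hes : ∀ i : Fin n, ∃ z : ℤ, MvPolynomial.aeval α (esymm σ ℤ (i + 1)) = (z : ℂ) := by
    intro i
    obtain ⟨z, hz⟩ := exists_int_eq_esymm_roots f hmon (i + 1)
    refine ⟨z, ?_⟩
    rw [aeval_esymm_eq_multiset_esymm, hα, hz]
  choose g hg using hes
  refine ⟨MvPolynomial.eval g T, ?_⟩
  rw [← hT', comp_aeval_apply]
  simp_rw [hg]
  -- `aeval (Int.cast ∘ g) T = Int.cast (eval g T)`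
  have h := eval₂_comp_left (Int.castRingHom ℂ) (RingHom.id ℤ) g T
  rw [MvPolynomial.aeval_def]
  have hcomp : (Int.castRingHom ℂ).comp (RingHom.id ℤ) = algebraMap ℤ ℂ := RingHom.ext_int _ _
  rw [hcomp] at h
  rw [show (fun i => ((g i : ℤ) : ℂ)) = (Int.castRingHom ℂ) ∘ g from rfl, ← h]
  rfl

/-! ### Application: `∏_{i≠j} (α_i^p - α_j^p)` is an integer -/

/-- The polynomial `∏_{i ≠ j} (X_i^p - X_j^p)` is symmetric. -/
theorem isSymmetric_prod_pow_sub_pow {σ : Type*} [Fintype σ] [DecidableEq σ] (p : ℕ) :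
    (∏ i : σ, ∏ j ∈ univ.erase i, ((X i : MvPolynomial σ ℤ) ^ p - X j ^ p)).IsSymmetric := by
  intro e
  simp only [map_prod, map_sub, map_pow, rename_X]
  -- reindex the inner product by `e`, then the outer one
  have hinner : ∀ i : σ, ∏ j ∈ univ.erase i, ((X (e i) : MvPolynomial σ ℤ) ^ p - X (e j) ^ p) =
      ∏ j ∈ univ.erase (e i), ((X (e i) : MvPolynomial σ ℤ) ^ p - X j ^ p) := by
    intro i
    exact Finset.prod_equiv e (fun j => by simp [e.injective.ne_iff]) (fun j _ => rfl)
  simp_rw [hinner]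
  exact Fintype.prod_equiv e _ (fun k => ∏ j ∈ univ.erase k, ((X k : MvPolynomial σ ℤ) ^ p - X j ^ p))
    (fun i => rfl)

/-- **`D_p = ∏_{i ≠ j} (α_i^p - α_j^p)` is an integer** for the roots `α` of a monic integer polynomial. -/
theorem exists_int_eq_prod_pow_sub_pow {σ : Type*} [Fintype σ] [DecidableEq σ] (f : Polynomial ℤ) (hmon : f.Monic)
    (α : σ → ℂ) (hα : (Finset.univ.val.map α : Multiset ℂ) = (f.map (Int.castRingHom ℂ)).roots) (p : ℕ) :
    ∃ z : ℤ, ∏ i : σ, ∏ j ∈ univ.erase i, (α i ^ p - α j ^ p) = (z : ℂ) := by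
  obtain ⟨z, hz⟩ := exists_int_eq_aeval_of_isSymmetric f hmon α hα _ (isSymmetric_prod_pow_sub_pow (σ := σ) p)
  refine ⟨z, ?_⟩
  rw [← hz]
  simp only [map_prod, map_sub, map_pow, aeval_X]

/-- Consequently `∏_{i ≠ j} |α_i^p - α_j^p| ≥ 1` unless it vanishes. -/
theorem one_le_norm_prod_pow_sub_pow {σ : Type*} [Fintype σ] [DecidableEq σ] (f : Polynomial ℤ) (hmon : f.Monic)
    (α : σ → ℂ) (hα : (Finset.univ.val.map α : Multiset ℂ) = (f.map (Int.castRingHom ℂ)).roots) (p : ℕ)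
    (hne : ∏ i : σ, ∏ j ∈ univ.erase i, (α i ^ p - α j ^ p) ≠ 0) :
    1 ≤ ∏ i : σ, ∏ j ∈ univ.erase i, ‖α i ^ p - α j ^ p‖ := by
  obtain ⟨z, hz⟩ := exists_int_eq_prod_pow_sub_pow f hmon α hα p
  have hz0 : z ≠ 0 := by
    rintro rfl
    rw [Int.cast_zero] at hz
    exact hne hz
  have h : ‖∏ i : σ, ∏ j ∈ univ.erase i, (α i ^ p - α j ^ p)‖ = ∏ i : σ, ∏ j ∈ univ.erase i, ‖α i ^ p - α j ^ p‖ := by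
    rw [norm_prod]
    exact Finset.prod_congr rfl fun i _ => norm_prod _ _
  rw [← h, hz, Complex.norm_intCast]
  exact_mod_cast Int.one_le_abs hz0

/-- The same for the plain discriminant-type product (`p = 1`): `∏_{i ≠ j} |α_i - α_j| ≥ 1` unless it vanishes. -/
theorem one_le_norm_prod_sub {σ : Type*} [Fintype σ] [DecidableEq σ] (f : Polynomial ℤ) (hmon : f.Monic)
    (α : σ → ℂ) (hα : (Finset.univ.val.map α : Multiset ℂ) = (f.map (Int.castRingHom ℂ)).roots)
    (hne : ∏ i : σ, ∏ j ∈ univ.erase i, (α i - α j) ≠ 0) :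
    1 ≤ ∏ i : σ, ∏ j ∈ univ.erase i, ‖α i - α j‖ := by
  have h := one_le_norm_prod_pow_sub_pow f hmon α hα 1 (by simpa using hne)
  simpa using h

end Summit.Ventures.DiscreteObjects.Mahler
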